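import Mathlib
import Summits.CriticalPhenomena.CardyFormulaZ2.Theorems.CardySelfRefinementGradientComparabilityStubSlopeBoundsBundle
import Summits.CriticalPhenomena.CardyFormulaZ2.Theorems.CardySelfRefinementCriticalPathRSWStubCone2Russo
import HarnessLib

/-!
# Slope bounds, Stage B ingredient: single-edge finite energy of `M_k(ρ,c)`, uniform in `(ρ,c)`

Crux `stmt-CriticalPhenomena-10269`
(`Summit.CriticalPhenomena.CardyFormulaZ2.Theses.CardySelfRefinement.GradientComparability`),
line `monotone-product-coordinates`, helper file of the stub `stub_slopeBounds`.  Vocabulary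
(`ax tb opn cfg prm M edgeOf`) from `CardySelfRefinementDefs`; bundle combinatorics from
`…StubSlopeBoundsBundle`; one-coordinate sections of `prodBernoulli` from
`…CriticalPathRSWStubCone2Russo`.

## Mathematics

The law `M_k(ρ,c) = (prodBernoulli (prm k ρ c)).map (cfg k)` is NOT a product measure on the
edges (the `k` sub-edges of a bundle are tied with probability `ρ`), but it has uniform finite
energy edge by edge: for every measurable `E`, every edge `e = edgeOf (v, d)` of `ℤ²`,
`0 ≤ ρ < 1` and `0 < c < 1`,

`M{ω | ω ∪ {e} ∈ E} ≤ K · M(E)` and `M{ω | ω ∖ {e} ∈ E} ≤ K · M(E)`,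
`K = 2^k/(1-ρ) + 1/c + 1/(1-c)`

(`M_real_insert_le_and_sdiff_le`, the registered sub-goal).  For an interior edge this is the
one-coordinate section of its own coin (bias `c`).  For an axial edge `(w j₀, d)` of the bundle
`(t, d)`: on the coin side, `cfg k T = cfg k ((T ∖ Tc) ∪ Q(T))` where `Tc` = selector + the `k`
own coins and `Q(T)` = own coins of the currently open sub-edges (`cfg_eq_cfg_pattern`: switch
the selector off and copy the sub-edge states onto the own coins); with the selector off,
toggling the own coin of `(w j₀, d)` toggles the edge.  Hence `{ω ∪ {e} ∈ E}` and `{ω ∖ {e} ∈ E}`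
pull back into `⋃_{Q ⊆ own coins} {T | cfg k ((T ∖ Tc) ∪ Q) ∈ E}`, and each piece, being
determined off `Tc`, is charged to the cylinder `{T ∩ Tc = Q}` of weight `(1-ρ) 2^{-k}`
(independence of disjoint coin sets); the cylinders are disjoint, so the union costs
`2^k/(1-ρ) · M(E)` in total (`real_biUnion_pattern_le`).  (Grimmett 1999 §2.4 (2.32), finite
energy; Newman–Schulman 1981.)
-/

noncomputable section

namespace Summit.CriticalPhenomena.CardyFormulaZ2.Theorems.CardySelfRefinement

open scoped Topology
open Filter Set MeasureTheory
open Literature.Probability.LatticeModels Literature.Probability.Percolation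
open Literature.Probability.Percolation.QuadCrossing
open Summit.CriticalPhenomena.CardyFormulaZ2.Theses.CardySelfRefinement

/-! ## The cylinder partition of a bundle -/

/-- **Charging the bundle patterns to disjoint cylinders.** For the bundle `(t, d)` with sub-edge
enumeration `w`, own coins `O` and `Tc = {selector} ∪ O`:
`P(⋃_{Q ⊆ O} {T | cfg k ((T ∖ Tc) ∪ Q) ∈ E}) ≤ 2^k/(1-ρ) · M_k(ρ,c)(E)`. -/
theorem real_biUnion_pattern_le (k : ℕ) {t : Site 2} {d : Fin 2} {w : ℕ → Site 2}
    (hw₁ : ∀ j, j < k → ax k (w j, d) ∧ tb k (w j, d) = t)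
    {ρ : ℝ} (hρ : ρ ∈ Set.Ico (0 : ℝ) 1) (c : ℝ) {E : Set (BondConfig (Site 2))}
    (hE : MeasurableSet E) :
    (prodBernoulli (prm k ρ c)).real
        (⋃ Q ∈ ((Finset.range k).image fun l => (w l, d, (0 : Fin 3))).powerset,
          {T | cfg k (T \ ↑(insert (t, d, (2 : Fin 3)) ((Finset.range k).image fun l => (w l, d, (0 : Fin 3))))
            ∪ ↑Q) ∈ E}) ≤
      2 ^ k / (1 - ρ) * (M k ρ c).real E := by
  classical
  set μ := prodBernoulli (prm k ρ c) with hμ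
  haveI : IsProbabilityMeasure μ := by rw [hμ]; infer_instance
  set own : ℕ → Site 2 × Fin 2 × Fin 3 := fun l => (w l, d, (0 : Fin 3)) with hown
  set O : Finset (Site 2 × Fin 2 × Fin 3) := (Finset.range k).image own with hO
  set Tc : Finset (Site 2 × Fin 2 × Fin 3) := insert (t, d, (2 : Fin 3)) O with hTc
  set Y : Finset (Site 2 × Fin 2 × Fin 3) → Set (Set (Site 2 × Fin 2 × Fin 3)) :=
    fun Q => {T | cfg k (T \ ↑Tc ∪ ↑Q) ∈ E} with hY
  set C : Finset (Site 2 × Fin 2 × Fin 3) → Set (Set (Site 2 × Fin 2 × Fin 3)) :=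
    fun Q => localCylinder (↑Tc : Set (Site 2 × Fin 2 × Fin 3)) ↑Q with hC
  have hEm : MeasurableSet ((cfg k) ⁻¹' E) := measurable_cfg k hE
  have h1ρ : 0 < 1 - ρ := by linarith [hρ.2]
  have hρ' : ρ ∈ Set.Icc (0 : ℝ) 1 := Set.Ico_subset_Icc_self hρ
  have hO2 : ∀ x ∈ O, x.2.2 = 0 := by
    intro x hx
    obtain ⟨l, -, rfl⟩ := Finset.mem_image.1 hx
    rfl
  have hiO : ((t, d, (2 : Fin 3)) : Site 2 × Fin 2 × Fin 3) ∉ O := fun h => by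
    simpa using hO2 _ h
  have hCm : ∀ Q, MeasurableSet (C Q) := fun Q => measurableSet_localCylinder Tc.countable_toSet _
  -- each pattern event is charged to its cylinder
  have hpiece : ∀ Q ∈ O.powerset, μ.real (Y Q) ≤ 2 ^ k / (1 - ρ) * μ.real ((cfg k) ⁻¹' E ∩ C Q) := by
    intro Q hQ
    have hQO : Q ⊆ O := Finset.mem_powerset.1 hQ
    have hCdet : DeterminedBy (C Q) (↑Tc : Set (Site 2 × Fin 2 × Fin 3)) := by
      rw [determinedBy_iff]
      intro S₁ S₂ h
      have h' : ∀ x ∈ Tc, (x ∈ S₁ ↔ x ∈ S₂) := fun x hx =>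
        ⟨fun h₁ => ((Set.ext_iff.1 h x).1 ⟨h₁, hx⟩).1, fun h₂ => ((Set.ext_iff.1 h x).2 ⟨h₂, hx⟩).1⟩
      simp only [hC, localCylinder, Set.mem_setOf_eq]
      exact forall₂_congr fun x hx => by rw [h' x hx]
    have hYdet : DeterminedBy (Y Q) (↑Tc : Set (Site 2 × Fin 2 × Fin 3))ᶜ := by
      rw [determinedBy_iff]
      intro S₁ S₂ h
      have h' : S₁ \ ↑Tc ∪ ↑Q = S₂ \ ↑Tc ∪ ↑Q := by rw [Set.sdiff_eq, Set.sdiff_eq, h]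
      simp only [hY, Set.mem_setOf_eq, h']
    have hgm : Measurable fun T : Set (Site 2 × Fin 2 × Fin 3) => T \ ↑Tc ∪ ↑Q :=
      measurable_set_iff.2 fun x => ((measurable_set_mem x).and measurable_const).or measurable_const
    have hYm : MeasurableSet (Y Q) := hgm hEm
    have hind : μ.real (C Q ∩ Y Q) = μ.real (C Q) * μ.real (Y Q) :=
      prodBernoulli_real_inter_of_determinedBy _ Tc hCdet hYdet (hCm Q) hYm
    have hCval : (1 - ρ) * (1 / 2) ^ k ≤ μ.real (C Q) := by
      rw [hC, hμ, prodBernoulli_real_localCylinder, hTc, Finset.prod_insert hiO]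
      have hsel : ((t, d, (2 : Fin 3)) : Site 2 × Fin 2 × Fin 3) ∉ (↑Q : Set _) := fun h => hiO (hQO h)
      have hp2 : (prm k ρ c (t, d, (2 : Fin 3)) : ℝ) = ρ := by
        simp [prm, Set.projIcc_of_mem _ hρ']
      have hcard : O.card ≤ k := Finset.card_image_le.trans (by simp)
      rw [if_neg hsel, hp2]
      refine mul_le_mul_of_nonneg_left ?_ h1ρ.le
      refine (pow_le_pow_of_le_one (by norm_num) (by norm_num) hcard).trans (le_of_eq ?_)
      rw [← Finset.prod_const]
      refine Finset.prod_congr rfl fun x hx => ?_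
      obtain ⟨l, hl, rfl⟩ := Finset.mem_image.1 hx
      have hax := (hw₁ l (Finset.mem_range.1 hl)).1
      have hval : (prm k ρ c (own l) : ℝ) = 1 / 2 := by
        simp [hown, prm, hax]
      rw [hval]
      split_ifs <;> norm_num
    have hsub : C Q ∩ Y Q ⊆ (cfg k) ⁻¹' E ∩ C Q := by
      rintro T ⟨hTC, hTY⟩
      have hTS : ∀ x ∈ Tc, (x ∈ T ↔ x ∈ Q) := fun x hx => by
        simpa using hTC x (Finset.mem_coe.2 hx)
      have hgT : T \ ↑Tc ∪ ↑Q = T := by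
        ext x
        by_cases hxT : x ∈ Tc
        · have hx := hTS x hxT
          simp only [Set.mem_union, Set.mem_sdiff, Finset.mem_coe, hxT, not_true_eq_false,
            and_false, false_or, hx]
        · have hxQ : x ∉ Q := fun h => hxT (Finset.mem_insert_of_mem (hQO h))
          simp only [Set.mem_union, Set.mem_sdiff, Finset.mem_coe, hxT, not_false_eq_true,
            and_true, hxQ, or_false]
      refine ⟨?_, hTC⟩
      have h := hTY
      simp only [hY, Set.mem_setOf_eq, hgT] at h
      exact h
    have hle : μ.real (C Q) * μ.real (Y Q) ≤ μ.real ((cfg k) ⁻¹' E ∩ C Q) := by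
      rw [← hind]
      exact measureReal_mono hsub
    have hpos : 0 < (1 - ρ) * (1 / 2 : ℝ) ^ k := by positivity
    have hkey : μ.real (Y Q) * ((1 - ρ) * (1 / 2) ^ k) ≤ μ.real ((cfg k) ⁻¹' E ∩ C Q) := by
      calc μ.real (Y Q) * ((1 - ρ) * (1 / 2) ^ k) ≤ μ.real (Y Q) * μ.real (C Q) := by gcongr
        _ = μ.real (C Q) * μ.real (Y Q) := mul_comm _ _
        _ ≤ μ.real ((cfg k) ⁻¹' E ∩ C Q) := hle
    rw [← le_div_iff₀ hpos] at hkey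
    refine hkey.trans (le_of_eq ?_)
    rw [one_div, inv_pow]
    field_simp
  -- the cylinders of distinct patterns are disjoint
  have hdisj : (↑O.powerset : Set (Finset (Site 2 × Fin 2 × Fin 3))).PairwiseDisjoint
      fun Q => (cfg k) ⁻¹' E ∩ C Q := by
    intro Q₁ h₁ Q₂ h₂ hne
    have h₁O : Q₁ ⊆ O := Finset.mem_powerset.1 (Finset.mem_coe.1 h₁)
    have h₂O : Q₂ ⊆ O := Finset.mem_powerset.1 (Finset.mem_coe.1 h₂)
    refine Set.disjoint_left.2 fun T hT₁ hT₂ => hne ?_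
    ext x
    constructor
    · intro hx
      have hxT : x ∈ (↑Tc : Set _) := Finset.mem_coe.2 (Finset.mem_insert_of_mem (h₁O hx))
      exact (hT₂.2 x hxT).1 ((hT₁.2 x hxT).2 hx)
    · intro hx
      have hxT : x ∈ (↑Tc : Set _) := Finset.mem_coe.2 (Finset.mem_insert_of_mem (h₂O hx))
      exact (hT₁.2 x hxT).1 ((hT₂.2 x hxT).2 hx)
  have hC0 : 0 ≤ (2 : ℝ) ^ k / (1 - ρ) := div_nonneg (by positivity) h1ρ.le
  calc μ.real (⋃ Q ∈ O.powerset, Y Q)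
      ≤ ∑ Q ∈ O.powerset, μ.real (Y Q) := measureReal_biUnion_finset_le _ _
    _ ≤ ∑ Q ∈ O.powerset, 2 ^ k / (1 - ρ) * μ.real ((cfg k) ⁻¹' E ∩ C Q) := Finset.sum_le_sum hpiece
    _ = 2 ^ k / (1 - ρ) * ∑ Q ∈ O.powerset, μ.real ((cfg k) ⁻¹' E ∩ C Q) := by rw [Finset.mul_sum]
    _ = 2 ^ k / (1 - ρ) * μ.real (⋃ Q ∈ O.powerset, ((cfg k) ⁻¹' E ∩ C Q)) := by
        rw [measureReal_biUnion_finset hdisj fun Q _ => hEm.inter (hCm Q)]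
    _ ≤ 2 ^ k / (1 - ρ) * μ.real ((cfg k) ⁻¹' E) := by
        refine mul_le_mul_of_nonneg_left (measureReal_mono ?_) hC0
        exact Set.iUnion₂_subset fun Q _ => Set.inter_subset_left
    _ = 2 ^ k / (1 - ρ) * (M k ρ c).real E := by
        rw [hμ, ← map_measureReal_apply (measurable_cfg k) hE]

open Classical in
/-- **Copying the sub-edge states onto the own coins.** Switching the selector of the bundle
`(t, d)` off and setting the own coin of every sub-edge to its current state does not change the
configuration: `cfg k T = cfg k ((T ∖ Tc) ∪ Q(T))`, `Q(T)` = own coins of the open sub-edges. -/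
theorem cfg_eq_cfg_pattern (k : ℕ) {t : Site 2} {d : Fin 2} {w : ℕ → Site 2}
    (hw₁ : ∀ j, j < k → ax k (w j, d) ∧ tb k (w j, d) = t)
    (hw₂ : ∀ v : Site 2, ax k (v, d) → tb k (v, d) = t → ∃ j, j < k ∧ v = w j)
    (T : Set (Site 2 × Fin 2 × Fin 3)) :
    cfg k T = cfg k (T \ ↑(insert (t, d, (2 : Fin 3)) ((Finset.range k).image fun l => (w l, d, (0 : Fin 3)))) ∪
      ↑(((Finset.range k).image fun l => (w l, d, (0 : Fin 3))).filter fun x => opn k T (x.1, x.2.1))) := by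
  classical
  set own : ℕ → Site 2 × Fin 2 × Fin 3 := fun l => (w l, d, (0 : Fin 3)) with hown
  set O : Finset (Site 2 × Fin 2 × Fin 3) := (Finset.range k).image own with hO
  set Tc : Finset (Site 2 × Fin 2 × Fin 3) := insert (t, d, (2 : Fin 3)) O with hTc
  set Q : Finset (Site 2 × Fin 2 × Fin 3) := O.filter fun x => opn k T (x.1, x.2.1) with hQ
  have hO2 : ∀ x ∈ O, x.2.2 = 0 := by
    intro x hx
    obtain ⟨l, -, rfl⟩ := Finset.mem_image.1 hx
    rfl
  have hiO : ((t, d, (2 : Fin 3)) : Site 2 × Fin 2 × Fin 3) ∉ O := fun h => by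
    simpa using hO2 _ h
  have hQO : Q ⊆ O := Finset.filter_subset _ _
  have hsel : ((t, d, (2 : Fin 3)) : Site 2 × Fin 2 × Fin 3) ∉ T \ ↑Tc ∪ ↑Q := by
    rintro (⟨-, h⟩ | h)
    · exact h (Finset.mem_coe.2 (Finset.mem_insert_self _ _))
    · exact hiO (hQO h)
  refine cfg_congr_bundle k hw₂ (fun x hxi hxo => ?_) (fun j hj => ?_)
  · have hxO : x ∉ O := fun h => by
      obtain ⟨l, hl, rfl⟩ := Finset.mem_image.1 h
      exact hxo l (Finset.mem_range.1 hl) rfl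
    have hxT : x ∉ (↑Tc : Set (Site 2 × Fin 2 × Fin 3)) := by
      simp only [hTc, Finset.coe_insert, Set.mem_insert_iff, Finset.mem_coe, not_or]
      exact ⟨hxi, hxO⟩
    have hxQ : x ∉ (↑Q : Set (Site 2 × Fin 2 × Fin 3)) := fun h => hxO (hQO h)
    simp only [Set.mem_union, Set.mem_sdiff, hxT, not_false_eq_true, and_true, hxQ, or_false]
  · have hmem : own j ∈ O := Finset.mem_image.2 ⟨_, Finset.mem_range.2 hj, rfl⟩
    rw [opn_subEdge k (hw₁ j hj) (T \ ↑Tc ∪ ↑Q)]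
    have ho : own j ∈ T \ ↑Tc ∪ ↑Q ↔ opn k T (w j, d) := by
      constructor
      · rintro (⟨-, h⟩ | h)
        · exact absurd (Finset.mem_coe.2 (Finset.mem_insert_of_mem hmem)) h
        · exact (Finset.mem_filter.1 h).2
      · exact fun h => Or.inr (Finset.mem_filter.2 ⟨hmem, h⟩)
    rw [← ho]
    constructor
    · exact fun h => Or.inr ⟨hsel, h⟩
    · rintro (⟨h, -⟩ | ⟨-, h⟩)
      · exact absurd h hsel
      · exact h

/-- **Finite energy at an axial edge (coin side).** For the sub-edge `e = edgeOf (w j₀, d)` of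
the bundle `(t, d)`, `0 ≤ ρ < 1`, any `c` and measurable `E`: both `P{T | cfg k T ∪ {e} ∈ E}` and
`P{T | cfg k T ∖ {e} ∈ E}` are at most `2^k/(1-ρ) · M_k(ρ,c)(E)`. -/
theorem real_insert_le_and_sdiff_le_of_subEdge (k : ℕ) {t : Site 2} {d : Fin 2} {w : ℕ → Site 2}
    (hw₁ : ∀ j, j < k → ax k (w j, d) ∧ tb k (w j, d) = t)
    (hw₂ : ∀ v : Site 2, ax k (v, d) → tb k (v, d) = t → ∃ j, j < k ∧ v = w j)
    {j₀ : ℕ} (hj₀ : j₀ < k) {ρ : ℝ} (hρ : ρ ∈ Set.Ico (0 : ℝ) 1) (c : ℝ)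
    {E : Set (BondConfig (Site 2))} (hE : MeasurableSet E) :
    (prodBernoulli (prm k ρ c)).real {T | insert (edgeOf (w j₀, d)) (cfg k T) ∈ E} ≤
        2 ^ k / (1 - ρ) * (M k ρ c).real E ∧
      (prodBernoulli (prm k ρ c)).real {T | cfg k T \ {edgeOf (w j₀, d)} ∈ E} ≤
        2 ^ k / (1 - ρ) * (M k ρ c).real E := by
  classical
  set own : ℕ → Site 2 × Fin 2 × Fin 3 := fun l => (w l, d, (0 : Fin 3)) with hown
  set O : Finset (Site 2 × Fin 2 × Fin 3) := (Finset.range k).image own with hO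
  set Tc : Finset (Site 2 × Fin 2 × Fin 3) := insert (t, d, (2 : Fin 3)) O with hTc
  haveI : IsProbabilityMeasure (prodBernoulli (prm k ρ c)) := inferInstance
  have hO2 : ∀ x ∈ O, x.2.2 = 0 := by
    intro x hx
    obtain ⟨l, -, rfl⟩ := Finset.mem_image.1 hx
    rfl
  have hiO : ((t, d, (2 : Fin 3)) : Site 2 × Fin 2 × Fin 3) ∉ O := fun h => by
    simpa using hO2 _ h
  have hmem₀ : own j₀ ∈ O := Finset.mem_image.2 ⟨_, Finset.mem_range.2 hj₀, rfl⟩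
  have hoT : own j₀ ∈ Tc := Finset.mem_insert_of_mem hmem₀
  -- the pattern of `T` and the selector-off sample
  have key : ∀ T : Set (Site 2 × Fin 2 × Fin 3), ∃ Q : Finset (Site 2 × Fin 2 × Fin 3), Q ⊆ O ∧
      cfg k T = cfg k (T \ ↑Tc ∪ ↑Q) ∧ (tb k (w j₀, d), d, (2 : Fin 3)) ∉ T \ ↑Tc ∪ ↑Q := by
    intro T
    refine ⟨O.filter fun x => opn k T (x.1, x.2.1), Finset.filter_subset _ _,
      cfg_eq_cfg_pattern k hw₁ hw₂ T, ?_⟩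
    rw [(hw₁ j₀ hj₀).2]
    rintro (⟨-, h⟩ | h)
    · exact h (Finset.mem_coe.2 (Finset.mem_insert_self _ _))
    · exact hiO (Finset.filter_subset _ _ h)
  have hbound := real_biUnion_pattern_le k hw₁ hρ c hE
  constructor
  · refine le_trans (measureReal_mono (fun T hT => ?_) (measure_ne_top _ _)) hbound
    obtain ⟨Q, hQO, hcfg, hsel⟩ := key T
    have hins : insert (edgeOf (w j₀, d)) (cfg k T) = cfg k (T \ ↑Tc ∪ ↑(insert (own j₀) Q)) := by
      rw [hcfg, ← cfg_insert_own_of_selector_notMem k _ hsel, Finset.coe_insert (own j₀) Q,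
        Set.union_insert]
    refine Set.mem_iUnion₂.2 ⟨insert (own j₀) Q, Finset.mem_powerset.2 (Finset.insert_subset hmem₀ hQO), ?_⟩
    show cfg k (T \ ↑Tc ∪ ↑(insert (own j₀) Q)) ∈ E
    rw [← hins]
    exact hT
  · refine le_trans (measureReal_mono (fun T hT => ?_) (measure_ne_top _ _)) hbound
    obtain ⟨Q, hQO, hcfg, hsel⟩ := key T
    have hnot : ((w j₀, d, (0 : Fin 3)) : Site 2 × Fin 2 × Fin 3) ∉ T \ (↑Tc : Set (Site 2 × Fin 2 × Fin 3)) :=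
      fun h => h.2 (Finset.mem_coe.2 hoT)
    have hsd : cfg k T \ {edgeOf (w j₀, d)} = cfg k (T \ ↑Tc ∪ ↑(Q.erase (own j₀))) := by
      rw [hcfg, ← cfg_sdiff_own_of_selector_notMem k _ hsel, Set.union_sdiff_distrib,
        Finset.coe_erase (own j₀) Q, Set.sdiff_singleton_eq_self hnot]
    refine Set.mem_iUnion₂.2 ⟨Q.erase (own j₀), Finset.mem_powerset.2 ((Finset.erase_subset _ _).trans hQO), ?_⟩
    show cfg k (T \ ↑Tc ∪ ↑(Q.erase (own j₀))) ∈ E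
    rw [← hsd]
    exact hT

/-- **Finite energy at an interior edge (coin side).** For a non-axial `(v, d)`, `0 < c < 1`, any
`ρ` and measurable `E`: `P{T | cfg k T ∪ {e} ∈ E} ≤ M(E)/c` and `P{T | cfg k T ∖ {e} ∈ E} ≤
M(E)/(1-c)`, `e = edgeOf (v, d)` (one-coordinate section at the own coin, of bias `c`). -/
theorem real_insert_le_and_sdiff_le_of_not_ax (k : ℕ) {v : Site 2} {d : Fin 2} (hax : ¬ ax k (v, d))
    (ρ : ℝ) {c : ℝ} (hc : c ∈ Set.Ioo (0 : ℝ) 1) {E : Set (BondConfig (Site 2))}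
    (hE : MeasurableSet E) :
    (prodBernoulli (prm k ρ c)).real {T | insert (edgeOf (v, d)) (cfg k T) ∈ E} ≤
        1 / c * (M k ρ c).real E ∧
      (prodBernoulli (prm k ρ c)).real {T | cfg k T \ {edgeOf (v, d)} ∈ E} ≤
        1 / (1 - c) * (M k ρ c).real E := by
  set μ := prodBernoulli (prm k ρ c) with hμ
  set i : Site 2 × Fin 2 × Fin 3 := (v, d, (0 : Fin 3)) with hi
  have hEm : MeasurableSet ((cfg k) ⁻¹' E) := measurable_cfg k hE
  have hsec := Cruxes.CriticalPathRSW.FiniteSizeEnvelope.Cone2.prodBernoulli_real_eq_sections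
    (prm k ρ c) hEm i
  have hpi : (prm k ρ c i : ℝ) = c := by
    simp [hi, prm, hax, Set.projIcc_of_mem _ (Set.Ioo_subset_Icc_self hc)]
  rw [hpi] at hsec
  have hM : (prodBernoulli (prm k ρ c)).real ((cfg k) ⁻¹' E) = (M k ρ c).real E := by
    rw [← map_measureReal_apply (measurable_cfg k) hE]
  have h1 : {T : Set (Site 2 × Fin 2 × Fin 3) | insert (edgeOf (v, d)) (cfg k T) ∈ E} =
      {T | insert i T ∈ (cfg k) ⁻¹' E} := by
    ext T
    simp only [Set.mem_setOf_eq, Set.mem_preimage, hi, cfg_insert_own k T hax]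
  have h2 : {T : Set (Site 2 × Fin 2 × Fin 3) | cfg k T \ {edgeOf (v, d)} ∈ E} =
      {T | T \ {i} ∈ (cfg k) ⁻¹' E} := by
    ext T
    simp only [Set.mem_setOf_eq, Set.mem_preimage, hi, cfg_sdiff_own k T hax]
  have ha : 0 ≤ (prodBernoulli (prm k ρ c)).real {T | insert i T ∈ (cfg k) ⁻¹' E} := measureReal_nonneg
  have hb : 0 ≤ (prodBernoulli (prm k ρ c)).real {T | T \ {i} ∈ (cfg k) ⁻¹' E} := measureReal_nonneg
  rw [h1, h2, ← hM, hsec]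
  constructor
  · rw [one_div, ← div_eq_inv_mul, le_div_iff₀ hc.1]
    nlinarith [hc.2]
  · rw [one_div, ← div_eq_inv_mul, le_div_iff₀ (by linarith [hc.2] : (0 : ℝ) < 1 - c)]
    nlinarith [hc.1]

/-- **Single-edge finite energy of `M_k(ρ,c)`, uniform in the parameters** (registered sub-goal
`M_real_insert_le_and_sdiff_le` of `stub_slopeBounds`, Stage B ingredient): for `0 < k`,
`0 ≤ ρ < 1`, `0 < c < 1`, every edge `e = edgeOf (v, d)` of `ℤ²` and every measurable `E`,
opening or closing `e` costs at most the factor `K = 2^k/(1-ρ) + 1/c + 1/(1-c)`: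
`M{ω | ω ∪ {e} ∈ E} ≤ K · M(E)` and `M{ω | ω ∖ {e} ∈ E} ≤ K · M(E)`. -/
theorem M_real_insert_le_and_sdiff_le :
    ∀ k : ℕ, 0 < k → ∀ ρ ∈ Set.Ico (0 : ℝ) 1, ∀ c ∈ Set.Ioo (0 : ℝ) 1, ∀ (v : Site 2) (d : Fin 2) (E : Set (BondConfig (Site 2))), MeasurableSet E → (M k ρ c).real {ω | insert (edgeOf (v, d)) ω ∈ E} ≤ (2 ^ k / (1 - ρ) + 1 / c + 1 / (1 - c)) * (M k ρ c).real E ∧ (M k ρ c).real {ω | ω \ {edgeOf (v, d)} ∈ E} ≤ (2 ^ k / (1 - ρ) + 1 / c + 1 / (1 - c)) * (M k ρ c).real E := by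
  intro k hk ρ hρ c hc v d E hE
  have hM0 : 0 ≤ (M k ρ c).real E := measureReal_nonneg
  have hA : 0 ≤ (2 : ℝ) ^ k / (1 - ρ) := div_nonneg (by positivity) (by linarith [hρ.2])
  have hB : 0 ≤ 1 / c := div_nonneg zero_le_one hc.1.le
  have hC : 0 ≤ 1 / (1 - c) := div_nonneg zero_le_one (by linarith [hc.2])
  have hins : (M k ρ c).real {ω | insert (edgeOf (v, d)) ω ∈ E} =
      (prodBernoulli (prm k ρ c)).real {T | insert (edgeOf (v, d)) (cfg k T) ∈ E} :=
    map_measureReal_apply (measurable_cfg k) (measurable_insert_pt _ hE)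
  have hsdf : (M k ρ c).real {ω | ω \ {edgeOf (v, d)} ∈ E} =
      (prodBernoulli (prm k ρ c)).real {T | cfg k T \ {edgeOf (v, d)} ∈ E} :=
    map_measureReal_apply (measurable_cfg k) (measurable_sdiff_pt _ hE)
  rw [hins, hsdf]
  by_cases hax : ax k (v, d)
  · obtain ⟨w, hw₁, hw₂, -⟩ := exists_bundle_param hk (tb k (v, d)) d
    obtain ⟨j₀, hj₀, hv⟩ := hw₂ v hax rfl
    have h := real_insert_le_and_sdiff_le_of_subEdge k hw₁ hw₂ hj₀ hρ c hE
    rw [← hv] at h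
    constructor
    · exact h.1.trans (by nlinarith)
    · exact h.2.trans (by nlinarith)
  · have h := real_insert_le_and_sdiff_le_of_not_ax k hax ρ hc hE
    constructor
    · exact h.1.trans (by nlinarith)
    · exact h.2.trans (by nlinarith)

end Summit.CriticalPhenomena.CardyFormulaZ2.Theorems.CardySelfRefinement

end
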